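import Summits.Schanuel.Schanuel.Theorems.ZilberEacResonantWitness
import Summits.Schanuel.Schanuel.Theorems.ZilberEacFibreCurveDensity
import Summits.Schanuel.Schanuel.Theorems.ZilberEacFibreCurveZerosEdge
import Summits.Schanuel.Schanuel.Theorems.ZilberEacParamSurfaceExamples
import HarnessLib

/-!
# The equimodular class, VI: the RESONANT DEGENERATE graph surfaces are dense —
# `{x₁ = -(im/2π)(x₀ - τ)² + κ, A(x₀) y₀ + B(x₀) = 0}`; the member of record
# `{x₁ = -i x₀²/(2π), x₀ y₀ = x₀ + 1}`

HONEST FRAMING.  Cell `pub-schanuel` (Zilber's Exponential-Algebraic Closedness, case ladder;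
host summit Schanuel), seat 2, gen 22.  Gen 18 (`fibreCurveSurface_residual_of_not_unprojectedDense`)
and gen 21 (`paramFibreCurve_residual_of_not_unprojectedDense`) typed the residual of
Mantova–Masser's density question over graph / polynomial-curve bases: the EQUIMODULAR class, whose
totally degenerate members (`|y₁| → const` along ALL exponential points, e.g.
`{x₁ = -i x₀²/(2π), x₀(y₀ - 1) = 1}` with `e^{x₁} → e^{-i/π}`) were recorded as "Shapiro/Schanuel-type":
THEOREM G (growth) provably cannot decide them.  This file DECIDES the resonant degenerate family
over graph bases with rational fibre `y₀ = -B(x₀)/A(x₀)`: **`unprojectedDense_resonantGraphSurface`**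
— `deg A = deg B ≥ 1`, `A, B` coprime, `lc B = -e^τ lc A` (the fibre root tends to `e^τ`),
`c = -im/(2π)` with `m ∈ ℤ ∖ {0}`, any `κ` ⟹ `{x₁ = c(x₀ - τ)² + κ, A(x₀)y₀ + B(x₀) = 0}` has
Zariski-dense exponential points; with the case certificate
(**`unprojectedDensityQuestion_resonantGraphSurface`**); the member of record
**`unprojectedDensityQuestion_instance_resonantParabola_ratFibre`** (`m = 1`, `τ = κ = 0`, `A = x`,
`B = -x - 1`; over the SAME base seat 1's constant-fibre `resonantParabola` is NOT dense — not free).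
MECHANISM (files I–V): at every exponential point `y₁ = w(1/x₀)` EXACTLY for a `w` analytic at `0`
(resonance `e^{c(2πik)²} = 1`), and `w` is transcendental over `ℂ(x₀)` because `log(-B/(e^τ A))` is
(files II–III); THEOREM T (file IV) concludes.  These members are equimodular
(`Re(c·i²) = 0`, `2·Re(c·i)·log|e^τ| + Re(-2cτ·i) = 0`), i.e. NOT covered by gens 17–21.  Complete
classes of instances of an OPEN question (PLMS 2024 §1 p. 5); EC(3,2) stays OPEN; NOT Schanuel's
conjecture (neither used nor implied; EAC ⇏ SC).
-/

noncomputable section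

open Filter Topology Set Complex MvPolynomial
open Literature.NumberTheory.Transcendental Literature.ModelTheory.Zilber
open Literature.ModelTheory.ExponentialFields

set_option linter.dupNamespace false

namespace Summit.Schanuel.Schanuel.Theorems

/-! ## Part A. The resonant family is dense -/

section Main

variable (A B : Polynomial ℂ) {P : MvPolynomial (Fin 2) ℂ}

/-- From a logarithmic strip `‖z_k - i n_k‖ ≤ A log n_k + B`, `n_k → ∞`: `‖z_k‖ → ∞`. [folklore] -/
theorem tendsto_norm_of_strip {z : ℕ → ℂ} {n : ℕ → ℝ} {Al Bl : ℝ} (hAl : 0 ≤ Al)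
    (hn : Tendsto n atTop atTop) (hnear : ∀ k, ‖z k - (n k : ℂ) * I‖ ≤ Al * Real.log (n k) + Bl) :
    Tendsto (fun k => ‖z k‖) atTop atTop := by
  have h := tendsto_sub_log_affine (N := fun k => n k / (2 * Real.pi))
    (hn.atTop_div_const Real.two_pi_pos) Al 0 Bl hAl le_rfl
  refine tendsto_atTop_mono (fun k => ?_) h
  have e : 2 * Real.pi * (n k / (2 * Real.pi)) = n k := by
    field_simp
  simp only [e, add_zero]
  have h1 : ‖(n k : ℂ) * I‖ = |n k| := by
    rw [norm_mul, Complex.norm_I, mul_one, Complex.norm_real, Real.norm_eq_abs]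
  have h2 : ‖(n k : ℂ) * I‖ ≤ ‖z k‖ + ‖z k - (n k : ℂ) * I‖ := by
    have := norm_sub_le (z k) (z k - (n k : ℂ) * I)
    simpa using this
  linarith [hnear k, le_abs_self (n k)]

/-- Resonance: `exp(c (2πik)²) = 1` for `c = -im/(2π)`. [folklore] -/
theorem exp_resonant_eq_one (m k : ℤ) :
    Complex.exp (-(I * m / (2 * Real.pi)) * ((k : ℂ) * (2 * Real.pi * I)) ^ 2) = 1 := by
  rw [Complex.exp_eq_one_iff]
  refine ⟨m * k ^ 2, ?_⟩
  have hπ : (Real.pi : ℂ) ≠ 0 := by exact_mod_cast Real.pi_ne_zero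
  have h2 : ((k : ℂ) * (2 * Real.pi * I)) ^ 2 = -(4 * Real.pi ^ 2 * k ^ 2) := by
    rw [mul_pow, mul_pow, Complex.I_sq]; ring
  rw [h2]
  push_cast
  field_simp
  ring

/-- **THE RESONANT DEGENERATE GRAPH SURFACES ARE DENSE.**  `P(x₀, y₀) = A(x₀) y₀ + B(x₀)`
irreducible (given through its evaluations), with two monomials of different `y₀`-degree;
`deg A = deg B ≥ 1`, `A, B` coprime, `lc B = -e^τ lc A`; `m ∈ ℤ ∖ {0}`, `κ ∈ ℂ`.  Then
`{x₁ = -(im/2π)(x₀ - τ)² + κ, P(x₀, y₀) = 0} ⊆ ℂ² × ℂ²` has Zariski-dense exponential points — by the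
transcendence mechanism (THEOREM T with the resonant witness), not by growth.
[cite: MantovaMasser2023, §1 Further remarks, p. 5 (the question, open in general)] (new) -/
theorem unprojectedDense_resonantGraphSurface
    (hP : ∀ x y : ℂ, MvPolynomial.eval ![x, y] P = A.eval x * y + B.eval x) (hirr : Irreducible P)
    (h1 : ∃ v ∈ P.support, ∃ v' ∈ P.support, v 1 ≠ v' 1) (hN : 1 ≤ A.natDegree)
    (hdeg : B.natDegree = A.natDegree) (hcop : IsCoprime A B) (τ κ : ℂ)
    (hlc : B.leadingCoeff = -Complex.exp τ * A.leadingCoeff) {m : ℤ} (hm : m ≠ 0) :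
    UnprojectedDense {w : Fin 2 ⊕ Fin 2 → ℂ |
      w (Sum.inl 1) = (Polynomial.C (-(I * m / (2 * Real.pi))) * (Polynomial.X - Polynomial.C τ) ^ 2 +
        Polynomial.C κ).eval (w (Sum.inl 0)) ∧
      MvPolynomial.eval ![w (Sum.inl 0), w (Sum.inr 0)] P = 0} := by
  set p : Polynomial ℂ := Polynomial.C (-(I * m / (2 * Real.pi))) *
    (Polynomial.X - Polynomial.C τ) ^ 2 + Polynomial.C κ with hp
  have hπ : (Real.pi : ℂ) ≠ 0 := by exact_mod_cast Real.pi_ne_zero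
  have hc0 : (-(I * m / (2 * Real.pi)) : ℂ) ≠ 0 := by
    rw [neg_ne_zero, div_ne_zero_iff]
    exact ⟨mul_ne_zero Complex.I_ne_zero (by exact_mod_cast hm), mul_ne_zero two_ne_zero hπ⟩
  obtain ⟨w, R, hw, -, hK2, htr⟩ := exists_resonant_witness A B hN hdeg hcop hc0 τ τ κ hlc
  -- zeros of `P(z, e^z)` in a logarithmic strip; their norms tend to infinity
  obtain ⟨z, n, Al, Bl, hAl, hn, hz, hnear⟩ := exists_fibreCurve_zeros P h1
  have hnormz : Tendsto (fun k => ‖z k‖) atTop atTop := tendsto_norm_of_strip hAl hn hnear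
  obtain ⟨k₀, hk₀⟩ := Filter.eventually_atTop.1 (hnormz.eventually_gt_atTop R)
  set z' : ℕ → ℂ := fun k => z (k + k₀) with hz'
  have hnormz' : Tendsto (fun k => ‖z' k‖) atTop atTop := hnormz.comp (tendsto_add_atTop_nat k₀)
  have hPz : ∀ k, A.eval (z' k) * Complex.exp (z' k) + B.eval (z' k) = 0 := fun k => by
    rw [← hP]; exact hz (k + k₀)
  -- the sequence of exponential points
  have hirr3 := irreducible_rename_castSucc₂ hirr
  rw [fibreCurveSurface_eq]
  set q : ℕ → Fin 2 ⊕ Fin 2 → ℂ := fun k =>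
    Sum.elim ![z' k, p.eval (z' k)] ![Complex.exp (z' k), Complex.exp (p.eval (z' k))] with hq
  have hqS : ∀ k, q k ∈ {w : Fin 2 ⊕ Fin 2 → ℂ | w (Sum.inl 1) = p.eval (w (Sum.inl 0)) ∧
      MvPolynomial.eval ![w (Sum.inl 0), w (Sum.inr 0), w (Sum.inr 1)]
        (rename (Fin.castSucc : Fin 2 → Fin 3) P) = 0} := by
    intro k
    refine ⟨by simp [hq], ?_⟩
    have e : (![q k (Sum.inl 0), q k (Sum.inr 0), q k (Sum.inr 1)] : Fin 3 → ℂ) =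
        ![z' k, Complex.exp (z' k), Complex.exp (p.eval (z' k))] := by
      simp [hq]
    rw [e, eval_vec3_rename_castSucc]
    exact hz (k + k₀)
  have hqΓ : ∀ k, q k ∈ expGraph ℂ 2 := by
    intro k
    rw [mem_expGraph_iff]
    intro i
    rw [Literature.ModelTheory.ExponentialFields.ExponentialRing.complex_exp_eq]
    fin_cases i <;> simp [hq]
  have hqnorm : Tendsto (fun k => ‖q k (Sum.inl 0)‖) atTop atTop := by
    refine hnormz'.congr fun k => ?_
    simp [hq]
  have hrel : ∀ k, q k (Sum.inr 1) = w (q k (Sum.inl 0))⁻¹ := by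
    intro k
    simp only [hq, Sum.elim_inr, Sum.elim_inl, Matrix.cons_val_one, Matrix.cons_val_zero]
    rw [hp]
    obtain ⟨j, -, hj⟩ := hK2 _ (hk₀ _ (Nat.le_add_left _ _)) (hPz k)
    rw [hj, sub_self, zero_add, exp_resonant_eq_one m j, one_mul]
  exact unprojectedDense_of_transcendental_relation (isIrreducibleClosed_graphSurface p hirr3)
    (by rw [zariskiDim_graphSurface p hirr3]) 0 1 hqS hqΓ hqnorm hw hrel htr

/-- The base polynomial has degree `2`. -/
theorem natDegree_resonantBase (τ κ : ℂ) {m : ℤ} (hm : m ≠ 0) :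
    (Polynomial.C (-(I * m / (2 * Real.pi))) * (Polynomial.X - Polynomial.C τ) ^ 2 +
      Polynomial.C κ).natDegree = 2 := by
  have hπ : (Real.pi : ℂ) ≠ 0 := by exact_mod_cast Real.pi_ne_zero
  have hc : (-(I * m / (2 * Real.pi)) : ℂ) ≠ 0 := by
    rw [neg_ne_zero, div_ne_zero_iff]
    exact ⟨mul_ne_zero Complex.I_ne_zero (by exact_mod_cast hm), mul_ne_zero two_ne_zero hπ⟩
  rw [Polynomial.natDegree_add_C, Polynomial.natDegree_C_mul hc, Polynomial.natDegree_pow,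
    Polynomial.natDegree_X_sub_C]

/-- **Mantova–Masser's question on the resonant degenerate family: case ∧ dense.**
[cite: MantovaMasser2023, §1 Further remarks, p. 5 (the question, open in general)] (new) -/
theorem unprojectedDensityQuestion_resonantGraphSurface
    (hP : ∀ x y : ℂ, MvPolynomial.eval ![x, y] P = A.eval x * y + B.eval x) (hirr : Irreducible P)
    (h1 : ∃ v ∈ P.support, ∃ v' ∈ P.support, v 1 ≠ v' 1) (hN : 1 ≤ A.natDegree)
    (hdeg : B.natDegree = A.natDegree) (hcop : IsCoprime A B) (τ κ : ℂ)
    (hlc : B.leadingCoeff = -Complex.exp τ * A.leadingCoeff) {m : ℤ} (hm : m ≠ 0) :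
    MMCaseDimPiOneFree {w : Fin 2 ⊕ Fin 2 → ℂ |
      w (Sum.inl 1) = (Polynomial.C (-(I * m / (2 * Real.pi))) * (Polynomial.X - Polynomial.C τ) ^ 2 +
        Polynomial.C κ).eval (w (Sum.inl 0)) ∧
      MvPolynomial.eval ![w (Sum.inl 0), w (Sum.inr 0)] P = 0} ∧
    UnprojectedDense {w : Fin 2 ⊕ Fin 2 → ℂ |
      w (Sum.inl 1) = (Polynomial.C (-(I * m / (2 * Real.pi))) * (Polynomial.X - Polynomial.C τ) ^ 2 +
        Polynomial.C κ).eval (w (Sum.inl 0)) ∧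
      MvPolynomial.eval ![w (Sum.inl 0), w (Sum.inr 0)] P = 0} := by
  refine ⟨mmCase_fibreCurveSurface _ (by rw [natDegree_resonantBase τ κ hm]) hirr ?_,
    unprojectedDense_resonantGraphSurface A B hP hirr h1 hN hdeg hcop τ κ hlc hm⟩
  -- torus fibres over every `t` with `A(t) B(t) ≠ 0`
  have hA0 : A ≠ 0 := by
    intro h; rw [h, Polynomial.natDegree_zero] at hN; omega
  have hB0 : B ≠ 0 := by
    intro h
    rw [h, Polynomial.leadingCoeff_zero] at hlc
    exact mul_ne_zero (neg_ne_zero.2 (Complex.exp_ne_zero τ)) (Polynomial.leadingCoeff_ne_zero.2 hA0)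
      hlc.symm
  refine ((Polynomial.finite_setOf_isRoot (mul_ne_zero hA0 hB0)).infinite_compl).mono ?_
  intro t ht
  simp only [Set.mem_compl_iff, Set.mem_setOf_eq, Polynomial.IsRoot, Polynomial.eval_mul,
    mul_eq_zero, not_or] at ht
  have hA : A.eval t ≠ 0 := ht.1
  refine ⟨-B.eval t / A.eval t, div_ne_zero (neg_ne_zero.2 ht.2) hA, ?_⟩
  rw [hP, mul_div_cancel₀ _ hA, neg_add_cancel]

/-! ## Part B'. Why THEOREM G is silent here: `e^{x₁}` CONVERGES along all exponential points -/

/-- **Along every sequence of exponential points the coordinate `y₁ = e^{x₁}` converges to a nonzero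
limit** (`= w(0)`): on the integer-resonant family no coordinate escapes. (new) -/
theorem resonant_expPoints_exp_tendsto (hN : 1 ≤ A.natDegree) (hdeg : B.natDegree = A.natDegree)
    (hcop : IsCoprime A B) (τ κ : ℂ) (hlc : B.leadingCoeff = -Complex.exp τ * A.leadingCoeff)
    {m : ℤ} (hm : m ≠ 0) :
    ∃ y : ℂ, y ≠ 0 ∧ ∀ z : ℕ → ℂ, (∀ k, A.eval (z k) * Complex.exp (z k) + B.eval (z k) = 0) →
      Tendsto (fun k => ‖z k‖) atTop atTop →
      Tendsto (fun k => Complex.exp ((Polynomial.C (-(I * m / (2 * Real.pi))) *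
        (Polynomial.X - Polynomial.C τ) ^ 2 + Polynomial.C κ).eval (z k))) atTop (𝓝 y) := by
  have hπ : (Real.pi : ℂ) ≠ 0 := by exact_mod_cast Real.pi_ne_zero
  have hc0 : (-(I * m / (2 * Real.pi)) : ℂ) ≠ 0 := by
    rw [neg_ne_zero, div_ne_zero_iff]
    exact ⟨mul_ne_zero Complex.I_ne_zero (by exact_mod_cast hm), mul_ne_zero two_ne_zero hπ⟩
  obtain ⟨w, R, hw, hw0, hK2, -⟩ := exists_resonant_witness A B hN hdeg hcop hc0 τ τ κ hlc
  refine ⟨w 0, hw0 0, fun z hz hnorm => ?_⟩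
  have hinv : Tendsto (fun k => (z k)⁻¹) atTop (𝓝 (0 : ℂ)) :=
    tendsto_inv₀_cobounded.comp (tendsto_norm_atTop_iff_cobounded.1 hnorm)
  have hlim : Tendsto (fun k => w (z k)⁻¹) atTop (𝓝 (w 0)) := hw.continuousAt.tendsto.comp hinv
  refine hlim.congr' ?_
  filter_upwards [hnorm.eventually_gt_atTop R] with k hk
  obtain ⟨j, -, hj⟩ := hK2 _ hk (hz k)
  rw [hj, sub_self, zero_add, exp_resonant_eq_one m j, one_mul]

/-- **THEOREM G's escape ratio tends to `0`** along every sequence of exponential points of the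
integer-resonant family (`Re x₁ → log|w(0)|` while `‖x₁‖ → ∞`): growth cannot decide these surfaces.
(new) -/
theorem resonant_expPoints_no_growth (hN : 1 ≤ A.natDegree) (hdeg : B.natDegree = A.natDegree)
    (hcop : IsCoprime A B) (τ κ : ℂ) (hlc : B.leadingCoeff = -Complex.exp τ * A.leadingCoeff)
    {m : ℤ} (hm : m ≠ 0) (z : ℕ → ℂ) (hz : ∀ k, A.eval (z k) * Complex.exp (z k) + B.eval (z k) = 0)
    (hnorm : Tendsto (fun k => ‖z k‖) atTop atTop) :
    Tendsto (fun k => |((Polynomial.C (-(I * m / (2 * Real.pi))) * (Polynomial.X - Polynomial.C τ) ^ 2 +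
        Polynomial.C κ).eval (z k)).re| /
      Real.log (2 + ‖(Polynomial.C (-(I * m / (2 * Real.pi))) * (Polynomial.X - Polynomial.C τ) ^ 2 +
        Polynomial.C κ).eval (z k)‖)) atTop (𝓝 0) := by
  set p : Polynomial ℂ := Polynomial.C (-(I * m / (2 * Real.pi))) *
    (Polynomial.X - Polynomial.C τ) ^ 2 + Polynomial.C κ with hp
  obtain ⟨y, hy0, hlim⟩ := resonant_expPoints_exp_tendsto A B hN hdeg hcop τ κ hlc hm
  have h1 : Tendsto (fun k => |(p.eval (z k)).re|) atTop (𝓝 |Real.log ‖y‖|) := by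
    have h2 : Tendsto (fun k => Real.log ‖Complex.exp (p.eval (z k))‖) atTop (𝓝 (Real.log ‖y‖)) :=
      ((Real.continuousAt_log (norm_ne_zero_iff.2 hy0)).tendsto.comp
        (continuous_norm.continuousAt.tendsto.comp (hlim z hz hnorm)))
    refine (h2.congr fun k => ?_).abs
    rw [Complex.norm_exp, Real.log_exp]
  have hdegp : 0 < p.degree := by
    rw [Polynomial.degree_eq_natDegree, hp, natDegree_resonantBase τ κ hm]
    · norm_num
    · intro h0
      have := natDegree_resonantBase τ κ hm
      rw [← hp, h0, Polynomial.natDegree_zero] at this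
      exact absurd this (by norm_num)
  have h3 : Tendsto (fun k => Real.log (2 + ‖p.eval (z k)‖)) atTop atTop := by
    refine Real.tendsto_log_atTop.comp (tendsto_atTop_add_const_left _ _ ?_)
    exact Polynomial.tendsto_norm_atTop p hdegp hnorm
  exact h1.div_atTop h3

end Main

/-! ## Part B. The member of record: `{x₁ = -i x₀²/(2π), x₀ y₀ = x₀ + 1}` -/

section Example

/-- `P = x₀ y₀ - x₀ - 1` evaluates as `x·y + (-x - 1)`. -/
theorem eval_resonantP (x y : ℂ) :
    MvPolynomial.eval ![x, y] (X 0 * X 1 - X 0 - 1 : MvPolynomial (Fin 2) ℂ) =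
      (Polynomial.X : Polynomial ℂ).eval x * y + (-Polynomial.X - 1 : Polynomial ℂ).eval x := by
  simp; ring

/-- `x₀ y₀ - x₀ - 1` is irreducible (degree one in `x₀` over `ℂ[y₀]` with unit... : via
`finSuccEquiv`, it is `C(y₀ - 1)·X + C(-1)`). -/
theorem irreducible_resonantP : Irreducible (X 0 * X 1 - X 0 - 1 : MvPolynomial (Fin 2) ℂ) := by
  have himage : MvPolynomial.finSuccEquiv ℂ 1 (X 0 * X 1 - X 0 - 1) =
      Polynomial.C (X 0 - 1 : MvPolynomial (Fin 1) ℂ) * Polynomial.X + Polynomial.C (-1) := by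
    rw [map_sub, map_sub, map_mul, map_one, MvPolynomial.finSuccEquiv_X_zero,
      show (X 1 : MvPolynomial (Fin 2) ℂ) = X (Fin.succ 0) from rfl, MvPolynomial.finSuccEquiv_X_succ,
      map_sub, map_one, map_neg, map_one]
    ring
  have ha : (X 0 - 1 : MvPolynomial (Fin 1) ℂ) ≠ 0 := by
    intro h
    have := congrArg (MvPolynomial.eval fun _ => (2 : ℂ)) h
    simp at this
    norm_num at this
  have hirr := irreducible_C_mul_X_add_C_of_isUnit (R := MvPolynomial (Fin 1) ℂ) ha
    (isUnit_one.neg)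
  rw [← himage] at hirr
  exact (MulEquiv.irreducible_iff (MvPolynomial.finSuccEquiv ℂ 1).toMulEquiv).1 hirr

/-- `P = x₀ y₀ - x₀ - 1` as a combination of monomials. -/
theorem resonantP_eq_monomials : (X 0 * X 1 - X 0 - 1 : MvPolynomial (Fin 2) ℂ) =
    MvPolynomial.monomial (Finsupp.single 0 1 + Finsupp.single 1 1) 1 -
      MvPolynomial.monomial (Finsupp.single 0 1) 1 - MvPolynomial.monomial 0 1 := by
  simp only [MvPolynomial.X, MvPolynomial.monomial_mul, one_mul]
  rfl

/-- `x₀ y₀` and `1` are monomials of `P` of different `y₀`-degree. -/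
theorem resonantP_support_pair : ∃ v ∈ (X 0 * X 1 - X 0 - 1 : MvPolynomial (Fin 2) ℂ).support,
    ∃ v' ∈ (X 0 * X 1 - X 0 - 1 : MvPolynomial (Fin 2) ℂ).support, v 1 ≠ v' 1 := by
  have hne1 : (Finsupp.single (0 : Fin 2) 1 + Finsupp.single 1 1 : Fin 2 →₀ ℕ) ≠
      Finsupp.single 0 1 := by
    intro h; have := DFunLike.congr_fun h 1; simp at this
  have hne2 : (Finsupp.single (0 : Fin 2) 1 + Finsupp.single 1 1 : Fin 2 →₀ ℕ) ≠ 0 := by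
    intro h; have := DFunLike.congr_fun h 1; simp at this
  have hne3 : (Finsupp.single (0 : Fin 2) 1 : Fin 2 →₀ ℕ) ≠ 0 := by
    intro h; have := DFunLike.congr_fun h 0; simp at this
  refine ⟨Finsupp.single 0 1 + Finsupp.single 1 1, ?_, 0, ?_, by simp⟩
  · rw [MvPolynomial.mem_support_iff, resonantP_eq_monomials]
    simp only [MvPolynomial.coeff_sub, MvPolynomial.coeff_monomial, if_neg hne1.symm,
      if_neg hne2.symm]
    norm_num
  · rw [MvPolynomial.mem_support_iff, resonantP_eq_monomials]
    simp only [MvPolynomial.coeff_sub, MvPolynomial.coeff_monomial, if_neg hne2, if_neg hne3]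
    norm_num

/-- **THE MEMBER OF RECORD IS DENSE: `{x₁ = -i x₀²/(2π), x₀ y₀ = x₀ + 1}`** (gen 18 O67 / gen 21
O74: the totally degenerate equimodular surface on which `e^{x₁} → e^{-i/π}` along all exponential
points) is in Mantova–Masser's case and has Zariski-dense exponential points — by transcendence of
`log(1 + 1/x₀)`, not by growth.  Contrast: over the SAME base `x₁ = x₀²/(2πi)` the constant fibre
`y₀ = 1` (seat 1's `resonantParabola`, not multiplicatively free) is NOT dense
(`Literature…not_unprojectedDense_resonantParabola`): the exponential points become dense as soon as
the fibre root varies rationally with `x₀`.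
[cite: MantovaMasser2023, §1 Further remarks, p. 5 (the question, open in general)] (new) -/
theorem unprojectedDensityQuestion_instance_resonantParabola_ratFibre :
    MMCaseDimPiOneFree {w : Fin 2 ⊕ Fin 2 → ℂ |
      w (Sum.inl 1) = -(I / (2 * Real.pi)) * w (Sum.inl 0) ^ 2 ∧
        w (Sum.inl 0) * w (Sum.inr 0) - w (Sum.inl 0) - 1 = 0} ∧
    UnprojectedDense {w : Fin 2 ⊕ Fin 2 → ℂ |
      w (Sum.inl 1) = -(I / (2 * Real.pi)) * w (Sum.inl 0) ^ 2 ∧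
        w (Sum.inl 0) * w (Sum.inr 0) - w (Sum.inl 0) - 1 = 0} := by
  have hset : {w : Fin 2 ⊕ Fin 2 → ℂ |
      w (Sum.inl 1) = -(I / (2 * Real.pi)) * w (Sum.inl 0) ^ 2 ∧
        w (Sum.inl 0) * w (Sum.inr 0) - w (Sum.inl 0) - 1 = 0} =
      {w : Fin 2 ⊕ Fin 2 → ℂ |
        w (Sum.inl 1) = (Polynomial.C (-(I * ((1 : ℤ) : ℂ) / (2 * Real.pi))) *
          (Polynomial.X - Polynomial.C 0) ^ 2 + Polynomial.C 0).eval (w (Sum.inl 0)) ∧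
        MvPolynomial.eval ![w (Sum.inl 0), w (Sum.inr 0)]
          (X 0 * X 1 - X 0 - 1 : MvPolynomial (Fin 2) ℂ) = 0} := by
    ext w
    simp only [Set.mem_setOf_eq, Int.cast_one, mul_one, map_zero, sub_zero, add_zero,
      Polynomial.eval_mul, Polynomial.eval_C, Polynomial.eval_pow, Polynomial.eval_X,
      MvPolynomial.eval_X, map_sub, map_mul, map_one, Matrix.cons_val_zero, Matrix.cons_val_one]
  rw [hset]
  refine unprojectedDensityQuestion_resonantGraphSurface Polynomial.X (-Polynomial.X - 1)
    eval_resonantP irreducible_resonantP resonantP_support_pair (by simp) ?_ ?_ 0 0 ?_ one_ne_zero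
  · rw [Polynomial.natDegree_X, show (-Polynomial.X - 1 : Polynomial ℂ) = -(Polynomial.X + Polynomial.C 1)
      by rw [map_one]; ring, Polynomial.natDegree_neg, Polynomial.natDegree_X_add_C]
  · exact ⟨-1, -1, by ring⟩
  · rw [show (-Polynomial.X - 1 : Polynomial ℂ) = -(Polynomial.X + Polynomial.C 1) by rw [map_one]; ring,
      Polynomial.leadingCoeff_neg, Polynomial.leadingCoeff_X_add_C, Polynomial.leadingCoeff_X,
      Complex.exp_zero]
    ring

/-- Plain-coordinate reading: **the exponential points of `{x₁ = -i x₀²/(2π), x₀ y₀ = x₀ + 1}` are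
Zariski dense.** [cite: MantovaMasser2023, §1 Further remarks, p. 5 (the question, open in general)]
(new) -/
theorem unprojectedDense_resonantParabola_ratFibre :
    UnprojectedDense {w : Fin 2 ⊕ Fin 2 → ℂ |
      w (Sum.inl 1) = -(I / (2 * Real.pi)) * w (Sum.inl 0) ^ 2 ∧
        w (Sum.inl 0) * w (Sum.inr 0) - w (Sum.inl 0) - 1 = 0} :=
  unprojectedDensityQuestion_instance_resonantParabola_ratFibre.2

end Example

end Summit.Schanuel.Schanuel.Theorems
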